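import Mathlib.Analysis.SpecialFunctions.Trigonometric.Bounds
import Mathlib.Analysis.SpecialFunctions.ExpDeriv
import Mathlib.Algebra.Order.Chebyshev
import Mathlib.MeasureTheory.Integral.DominatedConvergence
import Literature.MathematicalPhysics.QuantumLattice.OSAxiomsMeasure
import HarnessLib

/-!
# Reflection positivity for polynomials in the field (from OS3 on exponentials)

Topic `Literature/MathematicalPhysics/QuantumLattice` (trunk **T-AQFT**), a proved intermediate
result of the decomposition of the bridge `Literature.MathematicalPhysics.QuantumLattice.IsOSMeasure.exists_isOSFamily`
(measure-form OS axioms ⇒ distributional OS axioms), namely the analytic core of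
"OS3 ⇒ E2" (`Literature.MathematicalPhysics.QuantumLattice.IsSchwingerFamilyOf.isOSReflectionPositive`).

Glimm–Jaffe state reflection positivity OS3 [GJ 1987, §6.1, (6.1.8)] for the algebra `𝒜₊`
spanned by the exponentials `e^{iφ(f)}`, `f` real and supported at positive times
(`Literature.MathematicalPhysics.QuantumLattice.IsOS3ReflectionPositive`, the double-sum form `∑ᵢⱼ c̄ᵢ cⱼ S{fⱼ - θfᵢ} ≥ 0`), and use
it on the closure `𝓔₊ ⊇ 𝒜₊` in `L²(dμ)`, which contains the field polynomials
`A(φ) = ∑ᵢ cᵢ ∏ⱼ φ(fᵢⱼ)` as soon as `dμ` has moments (proof of [GJ 1987, Prop. 6.1.4]: `φ(f)ⁿ 1`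
is the strong limit of difference quotients of `e^{itφ(f)} 1`). Osterwalder–Schrader's (E2)
[OS 1973, §3 and (4.3)] is exactly `⟨θA, A⟩_{L²(dμ)} ≥ 0` for such polynomials `A` once the
Schwinger functions are the moments of `dμ`. This file proves:

* `Literature.MathematicalPhysics.QuantumLattice.IsOS3ReflectionPositive.fieldPolynomial_nonneg`: if `μ` is a finite measure on
  `𝒮'(ℝ^d)` with all moments (`HasAllMoments`) satisfying OS3, then for every field polynomial
  `A(ω) = ∑ᵢ cᵢ ∏ⱼ ω(fᵢⱼ)` with positive-time real test functions `fᵢⱼ`,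
  `∫ conj (A (θω)) · A(ω) dμ(ω)` is a nonnegative real.

## Proof

For `t ≠ 0` replace each factor `ω(f)` by the difference quotient
`q_t(ω(f)) = (e^{itω(f)} - 1)/(it)` (`expQuot`). Expanding the products
(`Finset.prod_add`), `A_t(ω) = ∑ᵢ cᵢ ∏ⱼ q_t(ω(fᵢⱼ))` is a finite combination of exponentials
`e^{iω(g)}` with `g = t ∑_{j ∈ S} fᵢⱼ` positive-time (`fieldPolynomialApprox_eq_expPolynomial`),
so OS3 gives `∫ conj (A_t(θω)) A_t(ω) dμ ≥ 0` (`integral_conj_theta_mul_expPolynomial_nonneg`, the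
double sum of OS3 being this integral, `sum_sum_genFunctional_eq_integral`). As `t → 0`,
`q_t(x) → x` (`tendsto_expQuot`) and `|q_t(x)| ≤ |x|` (`norm_expQuot_le`), so the integrands
converge pointwise and are dominated by `(G(θω)² + G(ω)²)/2`, `G(ω) = ∑ᵢ |cᵢ| ∏ⱼ |ω(fᵢⱼ)|`,
which is integrable by `HasAllMoments` (`integrable_absPolynomial_sq`); dominated convergence
(`MeasureTheory.tendsto_integral_filter_of_dominated_convergence` along `𝓝[≠] 0`) and closedness
of `{z | 0 ≤ re z ∧ im z = 0}` conclude. No Euclidean or reflection invariance of `μ` is used.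

## References

* J. Glimm, A. Jaffe, *Quantum Physics: a functional integral point of view*, 2nd ed. (1987),
  §6.1, (6.1.6)–(6.1.8), (6.1.11), Prop. 6.1.4. [GlimmJaffeQP1987]
* K. Osterwalder, R. Schrader, *Axioms for Euclidean Green's functions*, Comm. Math. Phys. 31
  (1973) 83–112, §3 (E2), §4.1 (4.3). [OsterwalderSchraderCMP1973]

## Mathlib

Used: `Real.norm_exp_I_mul_ofReal_sub_one_le`, `HasDerivAt.tendsto_slope_zero`,
`Finset.prod_add`, `Finset.prod_le_prod`, `sq_sum_le_card_mul_sum_sq`,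
`MeasureTheory.MemLp.integrable_norm_pow'`,
`MeasureTheory.tendsto_integral_filter_of_dominated_convergence`.
-/

open scoped SchwartzMap ComplexConjugate
open MeasureTheory Filter Topology Complex

noncomputable section

namespace Literature.MathematicalPhysics.QuantumLattice

/-! ### The exponential difference quotient -/

section ExpQuot

/-- The difference quotient `q_t(x) = (e^{itx} - 1)/(it)` of `s ↦ e^{isx}` at `s = 0`, divided by
`i` so that `q_t(x) → x` as `t → 0` (GJ §6.1, proof of Prop. 6.1.4). Junk value at `t = 0`
(division by zero): `0`. [folklore] -/
def expQuot (t x : ℝ) : ℂ :=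
  (cexp (I * ((t * x : ℝ) : ℂ)) - 1) / (I * (t : ℂ))

/-- `|q_t(x)| ≤ |x|` for `t ≠ 0`, from `|e^{iy} - 1| ≤ |y|`. [folklore] -/
theorem norm_expQuot_le {t : ℝ} (ht : t ≠ 0) (x : ℝ) : ‖expQuot t x‖ ≤ |x| := by
  unfold expQuot
  rw [norm_div]
  have hden : ‖I * (t : ℂ)‖ = |t| := by simp
  rw [hden, div_le_iff₀ (abs_pos.2 ht)]
  calc ‖cexp (I * ((t * x : ℝ) : ℂ)) - 1‖ ≤ ‖((t * x : ℝ))‖ :=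
        Real.norm_exp_I_mul_ofReal_sub_one_le
    _ = |x| * |t| := by rw [Real.norm_eq_abs, abs_mul, mul_comm]

/-- `q_t(x) → x` as `t → 0`, `t ≠ 0`: the derivative of `s ↦ e^{isx}` at `0` is `ix`. [folklore] -/
theorem tendsto_expQuot (x : ℝ) : Tendsto (fun t : ℝ => expQuot t x) (𝓝[≠] 0) (𝓝 (x : ℂ)) := by
  have hd : HasDerivAt (fun s : ℝ => cexp (I * ((s * x : ℝ) : ℂ))) (I * (x : ℂ)) 0 := by
    have h1 : HasDerivAt (fun s : ℝ => I * ((s * x : ℝ) : ℂ)) (I * (x : ℂ)) 0 := by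
      have h0 : HasDerivAt (fun s : ℝ => ((s * x : ℝ) : ℂ)) (x : ℂ) 0 := by
        have := ((hasDerivAt_id (0 : ℝ)).mul_const x).ofReal_comp
        simpa using this
      simpa using h0.const_mul I
    have h2 := h1.cexp
    simpa using h2
  have hs := hd.tendsto_slope_zero
  have heq : ∀ t : ℝ, (t⁻¹ • (cexp (I * (((0 + t) * x : ℝ) : ℂ)) -
      cexp (I * (((0 : ℝ) * x : ℝ) : ℂ)))) / I = expQuot t x := by
    intro t
    rw [zero_add, zero_mul, ofReal_zero, mul_zero, Complex.exp_zero, Complex.real_smul,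
      ofReal_inv, inv_mul_eq_div, div_div, mul_comm (t : ℂ) I]
    rfl
  have hlim : Tendsto (fun t : ℝ => (t⁻¹ • (cexp (I * (((0 + t) * x : ℝ) : ℂ)) -
      cexp (I * (((0 : ℝ) * x : ℝ) : ℂ)))) / I) (𝓝[≠] 0) (𝓝 (I * (x : ℂ) / I)) :=
    hs.div_const I
  rw [mul_div_cancel_left₀ _ I_ne_zero] at hlim
  exact hlim.congr heq

end ExpQuot

/-! ### Field polynomials and their exponential approximants -/

section Polynomial

variable {E : Type*} [NormedAddCommGroup E] [NormedSpace ℝ E]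
variable {ι : Type*} [Fintype ι] {m : ι → ℕ}

/-- A *field polynomial* (an element of the polynomial algebra generated by the Euclidean field,
GJ §6.1): `A(ω) = ∑ᵢ cᵢ ∏_{j < mᵢ} ω(fᵢⱼ)` for finitely many monomials `i : ι` of degrees `mᵢ`,
complex coefficients `cᵢ` and real test functions `fᵢⱼ`. [folklore] -/
def fieldPolynomial (c : ι → ℂ) (f : (i : ι) → Fin (m i) → 𝓢(E, ℝ)) (ω : FieldConfig E) : ℂ :=
  ∑ i, c i * ∏ j, (ω (f i j) : ℂ)

/-- The exponential approximant `A_t(ω) = ∑ᵢ cᵢ ∏ⱼ q_t(ω(fᵢⱼ))` of a field polynomial, each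
factor `ω(f)` being replaced by the difference quotient `(e^{itω(f)} - 1)/(it)` (GJ §6.1, proof of
Prop. 6.1.4). [folklore] -/
def fieldPolynomialApprox (t : ℝ) (c : ι → ℂ) (f : (i : ι) → Fin (m i) → 𝓢(E, ℝ))
    (ω : FieldConfig E) : ℂ :=
  ∑ i, c i * ∏ j, expQuot t (ω (f i j))

/-- The dominating function `G(ω) = ∑ᵢ |cᵢ| ∏ⱼ |ω(fᵢⱼ)|` of the approximants. [folklore] -/
def absPolynomial (c : ι → ℂ) (f : (i : ι) → Fin (m i) → 𝓢(E, ℝ)) (ω : FieldConfig E) : ℝ :=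
  ∑ i, ‖c i‖ * ∏ j, |ω (f i j)|

omit [Fintype ι] in
/-- A single monomial `ω ↦ ∏ⱼ ω(fⱼ)` is continuous for the weak-* topology. [folklore] -/
theorem continuous_monomial {n : ℕ} (f : Fin n → 𝓢(E, ℝ)) :
    Continuous fun ω : FieldConfig E => ∏ j, (ω (f j) : ℂ) :=
  continuous_finsetProd _ fun j _ => continuous_ofReal.comp (continuous_eval_const (f j))

/-- Field polynomials are continuous (hence measurable) functions of the configuration. [folklore] -/
theorem continuous_fieldPolynomial (c : ι → ℂ) (f : (i : ι) → Fin (m i) → 𝓢(E, ℝ)) :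
    Continuous (fieldPolynomial c f) :=
  continuous_finsetSum _ fun i _ => continuous_const.mul (continuous_monomial (f i))

/-- The exponential approximants are continuous functions of the configuration. [folklore] -/
theorem continuous_fieldPolynomialApprox (t : ℝ) (c : ι → ℂ)
    (f : (i : ι) → Fin (m i) → 𝓢(E, ℝ)) : Continuous (fieldPolynomialApprox t c f) := by
  refine continuous_finsetSum _ fun i _ => continuous_const.mul
    (continuous_finsetProd _ fun j _ => ?_)
  unfold expQuot
  fun_prop

/-- The dominating function is continuous. [folklore] -/
theorem continuous_absPolynomial (c : ι → ℂ) (f : (i : ι) → Fin (m i) → 𝓢(E, ℝ)) :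
    Continuous (absPolynomial c f) :=
  continuous_finsetSum _ fun i _ => continuous_const.mul
    (continuous_finsetProd _ fun j _ => continuous_abs.comp (continuous_eval_const (f i j)))

/-- Domination `|A_t(ω)| ≤ G(ω)` for `t ≠ 0` (from `|q_t(x)| ≤ |x|`). [folklore] -/
theorem norm_fieldPolynomialApprox_le {t : ℝ} (ht : t ≠ 0) (c : ι → ℂ)
    (f : (i : ι) → Fin (m i) → 𝓢(E, ℝ)) (ω : FieldConfig E) :
    ‖fieldPolynomialApprox t c f ω‖ ≤ absPolynomial c f ω := by
  unfold fieldPolynomialApprox absPolynomial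
  refine (norm_sum_le _ _).trans (Finset.sum_le_sum fun i _ => ?_)
  rw [norm_mul]
  refine mul_le_mul_of_nonneg_left ?_ (norm_nonneg _)
  rw [norm_prod]
  exact Finset.prod_le_prod (fun j _ => norm_nonneg _) fun j _ => norm_expQuot_le ht _

/-- Pointwise convergence `A_t(ω) → A(ω)` as `t → 0`, `t ≠ 0`. [folklore] -/
theorem tendsto_fieldPolynomialApprox (c : ι → ℂ) (f : (i : ι) → Fin (m i) → 𝓢(E, ℝ))
    (ω : FieldConfig E) :
    Tendsto (fun t : ℝ => fieldPolynomialApprox t c f ω) (𝓝[≠] 0)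
      (𝓝 (fieldPolynomial c f ω)) :=
  tendsto_finsetSum _ fun i _ => (tendsto_finsetProd _ fun j _ =>
    tendsto_expQuot (ω (f i j))).const_mul (c i)

/-- Elementary bound for products of `m` nonnegative reals: `∏ⱼ yⱼ ≤ 1 + ∑ⱼ yⱼ^m` (the product
is at most `(max yⱼ)^m`; the `1` covers the empty product). [folklore] -/
theorem prod_le_one_add_sum_pow {n : ℕ} (y : Fin n → ℝ) (hy : ∀ j, 0 ≤ y j) :
    ∏ j, y j ≤ 1 + ∑ j, y j ^ n := by
  rcases Nat.eq_zero_or_pos n with rfl | hn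
  · simp
  · haveI : Nonempty (Fin n) := ⟨⟨0, hn⟩⟩
    obtain ⟨j₀, -, hj₀⟩ := Finset.exists_max_image Finset.univ y Finset.univ_nonempty
    have h1 : ∏ j, y j ≤ y j₀ ^ n :=
      calc ∏ j, y j ≤ ∏ _j : Fin n, y j₀ :=
            Finset.prod_le_prod (fun j _ => hy j) fun j _ => hj₀ j (Finset.mem_univ j)
        _ = y j₀ ^ n := by simp
    have h2 : y j₀ ^ n ≤ ∑ j, y j ^ n :=
      Finset.single_le_sum (f := fun j => y j ^ n) (fun j _ => pow_nonneg (hy j) n)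
        (Finset.mem_univ j₀)
    linarith

/-- Pointwise bound `G(ω)² ≤ #ι ∑ᵢ |cᵢ|² (1 + ∑ⱼ |ω(fᵢⱼ)|^{2mᵢ})` (Cauchy–Schwarz for the finite
sum, then `prod_le_one_add_sum_pow`). [folklore] -/
theorem absPolynomial_sq_le (c : ι → ℂ) (f : (i : ι) → Fin (m i) → 𝓢(E, ℝ))
    (ω : FieldConfig E) :
    absPolynomial c f ω ^ 2 ≤
      Fintype.card ι * ∑ i, ‖c i‖ ^ 2 * (1 + ∑ j, |ω (f i j)| ^ (2 * m i)) := by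
  unfold absPolynomial
  refine (sq_sum_le_card_mul_sum_sq (s := Finset.univ)
    (f := fun i => ‖c i‖ * ∏ j, |ω (f i j)|)).trans ?_
  rw [Finset.card_univ]
  refine mul_le_mul_of_nonneg_left (Finset.sum_le_sum fun i _ => ?_) (Nat.cast_nonneg _)
  rw [mul_pow]
  refine mul_le_mul_of_nonneg_left ?_ (sq_nonneg _)
  rw [← Finset.prod_pow]
  refine (prod_le_one_add_sum_pow (fun j => |ω (f i j)| ^ 2) fun j => sq_nonneg _).trans ?_
  simp_rw [← pow_mul]
  rfl

/-- Under `HasAllMoments`, `G²` is integrable (finite measure): it is dominated by finitely many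
moments `|ω(f)|^{2m}` (GJ §6.1, Prop. 6.1.4: polynomials lie in `L²(dμ)`). [folklore] -/
theorem integrable_absPolynomial_sq {μ : Measure (FieldConfig E)} [IsFiniteMeasure μ]
    (hμ : HasAllMoments μ) (c : ι → ℂ) (f : (i : ι) → Fin (m i) → 𝓢(E, ℝ)) :
    Integrable (fun ω => absPolynomial c f ω ^ 2) μ := by
  have hdom : Integrable (fun ω : FieldConfig E =>
      (Fintype.card ι : ℝ) * ∑ i, ‖c i‖ ^ 2 * (1 + ∑ j, |ω (f i j)| ^ (2 * m i))) μ := by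
    refine Integrable.const_mul (integrable_finsetSum _ fun i _ =>
      Integrable.const_mul (Integrable.add (integrable_const _)
        (integrable_finsetSum _ fun j _ => ?_)) _) _
    have h := (hμ ((2 * m i : ℕ) : NNReal) (f i j)).integrable_norm_pow' (p := 2 * m i)
    · simpa [Real.norm_eq_abs] using h
  refine hdom.mono' ((continuous_absPolynomial c f).pow 2).aestronglyMeasurable
    (ae_of_all _ fun ω => ?_)
  rw [Real.norm_eq_abs, abs_of_nonneg (sq_nonneg _)]
  exact absPolynomial_sq_le c f ω

end Polynomial

/-! ### Exponential polynomials and OS3 in integral form -/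

section Exponential

variable {E : Type*} [NormedAddCommGroup E] [NormedSpace ℝ E]

/-- An *exponential polynomial* `B(ω) = ∑ₖ cₖ e^{iω(gₖ)}` (an element of the algebra `𝒜` of
GJ §6.1, (6.1.6)). [folklore] -/
def expPolynomial {K : Type*} [Fintype K] (c : K → ℂ) (g : K → 𝓢(E, ℝ)) (ω : FieldConfig E) : ℂ :=
  ∑ k, c k * cexp (I * (ω (g k) : ℂ))

/-- Exponential polynomials are continuous functions of the configuration. [folklore] -/
theorem continuous_expPolynomial {K : Type*} [Fintype K] (c : K → ℂ) (g : K → 𝓢(E, ℝ)) :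
    Continuous (expPolynomial c g) := by
  unfold expPolynomial
  fun_prop

/-- `|B(ω)| ≤ ∑ₖ |cₖ|`. [folklore] -/
theorem norm_expPolynomial_le {K : Type*} [Fintype K] (c : K → ℂ) (g : K → 𝓢(E, ℝ))
    (ω : FieldConfig E) : ‖expPolynomial c g ω‖ ≤ ∑ k, ‖c k‖ := by
  unfold expPolynomial
  refine (norm_sum_le _ _).trans (Finset.sum_le_sum fun k _ => ?_)
  rw [norm_mul, Complex.norm_exp_I_mul_ofReal, mul_one]

variable {ι : Type*} [Fintype ι] {m : ι → ℕ}

/-- The index type of the exponential expansion of `A_t`: a monomial `i` and a subset `S` of its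
factors (the subsets arise from `Finset.prod_add`). [folklore] -/
abbrev ExpIndex (m : ι → ℕ) : Type _ := (i : ι) × Finset (Fin (m i))

/-- Coefficients of the exponential expansion of `A_t`:
`cᵢ (it)^{-mᵢ} (-1)^{mᵢ - |S|}`. [folklore] -/
def approxCoeff (t : ℝ) (c : ι → ℂ) (k : ExpIndex m) : ℂ :=
  c k.1 * (I * (t : ℂ))⁻¹ ^ (m k.1) * (-1) ^ (m k.1 - k.2.card)

/-- Test functions of the exponential expansion of `A_t`: `t ∑_{j ∈ S} fᵢⱼ`. [folklore] -/
def approxTest (t : ℝ) (f : (i : ι) → Fin (m i) → 𝓢(E, ℝ)) (k : ExpIndex m) : 𝓢(E, ℝ) :=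
  t • ∑ j ∈ k.2, f k.1 j

/-- **Expansion of the approximant into exponentials**: for `t ≠ 0`,
`A_t(ω) = ∑_{(i,S)} cᵢ (it)^{-mᵢ} (-1)^{mᵢ-|S|} e^{iω(t ∑_{j∈S} fᵢⱼ)}` (`Finset.prod_add` applied to
`∏ⱼ (e^{itω(fᵢⱼ)} + (-1))`). [folklore] -/
theorem fieldPolynomialApprox_eq_expPolynomial {t : ℝ} (ht : t ≠ 0) (c : ι → ℂ)
    (f : (i : ι) → Fin (m i) → 𝓢(E, ℝ)) (ω : FieldConfig E) :
    fieldPolynomialApprox t c f ω = expPolynomial (approxCoeff t c) (approxTest t f) ω := by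
  unfold fieldPolynomialApprox expPolynomial
  rw [Fintype.sum_sigma]
  refine Finset.sum_congr rfl fun i _ => ?_
  have hIt : I * (t : ℂ) ≠ 0 := mul_ne_zero I_ne_zero (ofReal_ne_zero.2 ht)
  -- pull out the denominators
  have hq : ∀ j, expQuot t (ω (f i j)) =
      (I * (t : ℂ))⁻¹ * (cexp (I * ((t : ℂ) * (ω (f i j) : ℂ))) + (-1)) := by
    intro j
    unfold expQuot
    push_cast
    field_simp
    ring
  simp_rw [hq]
  rw [Finset.prod_mul_distrib, Finset.prod_const, Finset.card_univ, Fintype.card_fin,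
    Finset.prod_add, ← Finset.powerset_univ, Finset.mul_sum, Finset.mul_sum]
  refine Finset.sum_congr rfl fun S _ => ?_
  have hexp : ∏ j ∈ S, cexp (I * ((t : ℂ) * (ω (f i j) : ℂ))) =
      cexp (I * (ω (approxTest t f ⟨i, S⟩) : ℂ)) := by
    rw [← Complex.exp_sum, approxTest, map_smul, map_sum, smul_eq_mul]
    push_cast
    simp only [Finset.mul_sum]
  have hneg : ∏ j ∈ Finset.univ \ S, (-1 : ℂ) = (-1) ^ (m i - S.card) := by
    rw [Finset.prod_const, ← Finset.compl_eq_univ_sdiff, Finset.card_compl, Fintype.card_fin]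
  rw [hexp, hneg, approxCoeff]
  ring

variable {d : ℕ} [NeZero d]

omit [Fintype ι] in
/-- The test functions of the expansion are positive-time when all `fᵢⱼ` are (`𝒮₊` is a
subspace, `positiveTimeSubmodule`). [folklore] -/
theorem isPositiveTime_approxTest (t : ℝ)
    {f : (i : ι) → Fin (m i) → 𝓢(EuclideanSpace ℝ (Fin d), ℝ)}
    (hf : ∀ i j, IsPositiveTime (f i j)) (k : ExpIndex m) : IsPositiveTime (approxTest t f k) := by
  rw [← mem_positiveTimeSubmodule (𝕜 := ℝ), approxTest]
  exact Submodule.smul_mem _ _ (Submodule.sum_mem _ fun j _ =>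
    (mem_positiveTimeSubmodule (𝕜 := ℝ)).2 (hf k.1 j))

/-- OS3 for families indexed by an arbitrary finite type (reindexing `Fintype.equivFin`). [folklore] -/
theorem IsOS3ReflectionPositive.of_fintype {μ : Measure (FieldConfig (EuclideanSpace ℝ (Fin d)))}
    (h3 : IsOS3ReflectionPositive d μ) {K : Type*} [Fintype K] (c : K → ℂ)
    (g : K → 𝓢(EuclideanSpace ℝ (Fin d), ℝ)) (hg : ∀ k, IsPositiveTime (g k)) :
    let z := ∑ k, ∑ l, conj (c k) * c l * genFunctional μ (g l - thetaTest d (g k))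
    0 ≤ z.re ∧ z.im = 0 := by
  intro z
  set e := Fintype.equivFin K
  have h := h3 (Fintype.card K) (c ∘ e.symm) (g ∘ e.symm) fun i => hg _
  have hz : z = ∑ i, ∑ j, conj ((c ∘ e.symm) i) * (c ∘ e.symm) j *
      genFunctional μ ((g ∘ e.symm) j - thetaTest d ((g ∘ e.symm) i)) := by
    simp only [z, Function.comp_apply]
    rw [← e.symm.sum_comp]
    refine Finset.sum_congr rfl fun i _ => ?_
    rw [← e.symm.sum_comp]
  rw [hz]
  exact h

/-- **The OS3 double sum is an `L²`-type pairing**: for a finite measure,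
`∑ₖₗ c̄ₖ cₗ S{gₗ - θgₖ} = ∫ conj (B(θω)) B(ω) dμ(ω)` with `B = ∑ₖ cₖ e^{iω(gₖ)}`, since
`(θω)(g) = ω(θg)` and `conj e^{iy} = e^{-iy}` (GJ §6.1, (6.1.8) `⟨θA, A⟩ = ∫ (θA)⁻ A dμ`). [cite: GlimmJaffeQP1987, §6.1 (6.1.8)] -/
theorem sum_sum_genFunctional_eq_integral {μ : Measure (FieldConfig (EuclideanSpace ℝ (Fin d)))}
    [IsFiniteMeasure μ] {K : Type*} [Fintype K] (c : K → ℂ)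
    (g : K → 𝓢(EuclideanSpace ℝ (Fin d), ℝ)) :
    ∑ k, ∑ l, conj (c k) * c l * genFunctional μ (g l - thetaTest d (g k)) =
      ∫ ω, conj (expPolynomial c g (thetaField d ω)) * expPolynomial c g ω ∂μ := by
  have hint : ∀ k l, Integrable (fun ω : FieldConfig (EuclideanSpace ℝ (Fin d)) =>
      conj (c k * cexp (I * (ω (thetaTest d (g k)) : ℂ))) * (c l * cexp (I * (ω (g l) : ℂ)))) μ := by
    intro k l
    refine (integrable_const (‖c k‖ * ‖c l‖)).mono' (by fun_prop) (ae_of_all _ fun ω => ?_)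
    rw [norm_mul, norm_conj, norm_mul, norm_mul, Complex.norm_exp_I_mul_ofReal,
      Complex.norm_exp_I_mul_ofReal, mul_one, mul_one]
  have hterm : ∀ k l, conj (c k) * c l * genFunctional μ (g l - thetaTest d (g k)) =
      ∫ ω, conj (c k * cexp (I * (ω (thetaTest d (g k)) : ℂ))) *
        (c l * cexp (I * (ω (g l) : ℂ))) ∂μ := by
    intro k l
    rw [genFunctional, ← integral_const_mul]
    refine integral_congr_ae (ae_of_all _ fun ω => ?_)
    simp only [map_sub, ofReal_sub, map_mul, ← Complex.exp_conj, conj_I, conj_ofReal]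
    rw [show I * ((ω (g l) : ℂ) - (ω (thetaTest d (g k)) : ℂ)) =
      -I * (ω (thetaTest d (g k)) : ℂ) + I * (ω (g l) : ℂ) by ring, Complex.exp_add]
    ring
  simp_rw [hterm]
  have hinner : ∀ k, ∑ l, ∫ ω, conj (c k * cexp (I * (ω (thetaTest d (g k)) : ℂ))) *
      (c l * cexp (I * (ω (g l) : ℂ))) ∂μ = ∫ ω, ∑ l, conj (c k * cexp (I * (ω (thetaTest d (g k)) : ℂ))) *
      (c l * cexp (I * (ω (g l) : ℂ))) ∂μ :=
    fun k => (integral_finsetSum _ fun l _ => hint k l).symm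
  simp_rw [hinner]
  rw [← integral_finsetSum _ fun k _ => integrable_finsetSum _ fun l _ => hint k l]
  refine integral_congr_ae (ae_of_all _ fun ω => ?_)
  simp only [expPolynomial, thetaField_apply, map_sum, Finset.sum_mul, Finset.mul_sum]
  exact Finset.sum_comm

/-- OS3 in integral form: `∫ conj (B(θω)) B(ω) dμ ≥ 0` (a nonnegative real) for every exponential
polynomial `B = ∑ₖ cₖ e^{iω(gₖ)}` with positive-time `gₖ` — GJ's formulation (6.1.8) of OS3 on
`𝒜₊`, obtained from the double-sum form `IsOS3ReflectionPositive` (6.1.4). [cite: GlimmJaffeQP1987, §6.1 (6.1.8)] -/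
theorem IsOS3ReflectionPositive.integral_conj_theta_mul_expPolynomial_nonneg
    {μ : Measure (FieldConfig (EuclideanSpace ℝ (Fin d)))} [IsFiniteMeasure μ]
    (h3 : IsOS3ReflectionPositive d μ) {K : Type*} [Fintype K] (c : K → ℂ)
    (g : K → 𝓢(EuclideanSpace ℝ (Fin d), ℝ)) (hg : ∀ k, IsPositiveTime (g k)) :
    let z := ∫ ω, conj (expPolynomial c g (thetaField d ω)) * expPolynomial c g ω ∂μ
    0 ≤ z.re ∧ z.im = 0 := by
  intro z
  have h := h3.of_fintype c g hg
  rwa [sum_sum_genFunctional_eq_integral] at h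

end Exponential

/-! ### Reflection positivity for field polynomials -/

section Main

variable {d : ℕ} [NeZero d]
variable {ι : Type*} [Fintype ι] {m : ι → ℕ}

/-- **Reflection positivity extends from exponentials to field polynomials** (Glimm–Jaffe 1987,
§6.1: OS3 (6.1.8) on `𝒜₊` and the form `b` of (6.1.11) on `𝓔₊ ⊇` polynomials, via the
difference-quotient argument of Prop. 6.1.4; this is Osterwalder–Schrader's (E2), OS 1973 §3 and
(4.3), for the moments of `μ`). Let `μ` be a finite measure on `𝒮'(ℝ^d)` with all moments,
satisfying OS3 (`IsOS3ReflectionPositive`: `∑ᵢⱼ c̄ᵢ cⱼ S{fⱼ - θfᵢ} ≥ 0` for positive-time real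
`fᵢ`). Then for every field polynomial `A(ω) = ∑ᵢ cᵢ ∏ⱼ ω(fᵢⱼ)` with positive-time real test
functions `fᵢⱼ`, `∫ conj (A(θω)) A(ω) dμ(ω)` is a nonnegative real. No invariance of `μ` is
used. [cite: GlimmJaffeQP1987, §6.1 (6.1.8) and Prop. 6.1.4] -/
theorem IsOS3ReflectionPositive.fieldPolynomial_nonneg
    {μ : Measure (FieldConfig (EuclideanSpace ℝ (Fin d)))} [IsFiniteMeasure μ]
    (h3 : IsOS3ReflectionPositive d μ) (hμ : HasAllMoments μ) (c : ι → ℂ)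
    (f : (i : ι) → Fin (m i) → 𝓢(EuclideanSpace ℝ (Fin d), ℝ)) (hf : ∀ i j, IsPositiveTime (f i j)) :
    let z := ∫ ω, conj (fieldPolynomial c f (thetaField d ω)) * fieldPolynomial c f ω ∂μ
    0 ≤ z.re ∧ z.im = 0 := by
  intro z
  -- the approximating integrals
  set F : ℝ → FieldConfig (EuclideanSpace ℝ (Fin d)) → ℂ := fun t ω =>
    conj (fieldPolynomialApprox t c f (thetaField d ω)) * fieldPolynomialApprox t c f ω
  -- positivity of each approximating integral (OS3 on exponentials)
  have hpos : ∀ t : ℝ, t ≠ 0 → 0 ≤ (∫ ω, F t ω ∂μ).re ∧ (∫ ω, F t ω ∂μ).im = 0 := by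
    intro t ht
    have h := h3.integral_conj_theta_mul_expPolynomial_nonneg (approxCoeff t c) (approxTest t f)
      (isPositiveTime_approxTest t hf)
    have hF : F t = fun ω => conj (expPolynomial (approxCoeff t c) (approxTest t f) (thetaField d ω)) *
        expPolynomial (approxCoeff t c) (approxTest t f) ω := by
      funext ω
      simp only [F, fieldPolynomialApprox_eq_expPolynomial ht]
    rw [hF]
    exact h
  -- dominated convergence as `t → 0`
  set bound : FieldConfig (EuclideanSpace ℝ (Fin d)) → ℝ := fun ω =>
    (absPolynomial c (fun i j => thetaTest d (f i j)) ω ^ 2 + absPolynomial c f ω ^ 2) / 2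
  have hmeas : ∀ᶠ t in 𝓝[≠] (0 : ℝ), AEStronglyMeasurable (F t) μ :=
    Eventually.of_forall fun t => (Continuous.mul
      ((continuous_fieldPolynomialApprox t c f).comp (thetaField d).continuous).star
      (continuous_fieldPolynomialApprox t c f)).aestronglyMeasurable
  have hbound : ∀ᶠ t in 𝓝[≠] (0 : ℝ), ∀ᵐ ω ∂μ, ‖F t ω‖ ≤ bound ω := by
    filter_upwards [self_mem_nhdsWithin] with t ht
    refine ae_of_all _ fun ω => ?_
    have h1 : ‖fieldPolynomialApprox t c f (thetaField d ω)‖ ≤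
        absPolynomial c (fun i j => thetaTest d (f i j)) ω := by
      have := norm_fieldPolynomialApprox_le ht c f (thetaField d ω)
      simpa only [absPolynomial, thetaField_apply] using this
    have h2 : ‖fieldPolynomialApprox t c f ω‖ ≤ absPolynomial c f ω :=
      norm_fieldPolynomialApprox_le ht c f ω
    have ha : 0 ≤ absPolynomial c (fun i j => thetaTest d (f i j)) ω :=
      (norm_nonneg _).trans h1
    have hb : 0 ≤ absPolynomial c f ω := (norm_nonneg _).trans h2
    simp only [F, bound, norm_mul, norm_conj]
    nlinarith [mul_le_mul h1 h2 (norm_nonneg _) ha,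
      two_mul_le_add_sq (absPolynomial c (fun i j => thetaTest d (f i j)) ω) (absPolynomial c f ω)]
  have hint : Integrable bound μ :=
    ((integrable_absPolynomial_sq hμ c _).add (integrable_absPolynomial_sq hμ c f)).div_const 2
  have hlim : ∀ᵐ ω ∂μ, Tendsto (fun t => F t ω) (𝓝[≠] (0 : ℝ))
      (𝓝 (conj (fieldPolynomial c f (thetaField d ω)) * fieldPolynomial c f ω)) :=
    ae_of_all _ fun ω => ((continuous_conj.tendsto _).comp
      (tendsto_fieldPolynomialApprox c f (thetaField d ω))).mul
        (tendsto_fieldPolynomialApprox c f ω)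
  have hT : Tendsto (fun t => ∫ ω, F t ω ∂μ) (𝓝[≠] (0 : ℝ)) (𝓝 z) :=
    tendsto_integral_filter_of_dominated_convergence bound hmeas hbound hint hlim
  -- closedness of the nonnegative reals inside `ℂ`
  have hev : ∀ᶠ t in 𝓝[≠] (0 : ℝ), 0 ≤ (∫ ω, F t ω ∂μ).re ∧ (∫ ω, F t ω ∂μ).im = 0 := by
    filter_upwards [self_mem_nhdsWithin] with t ht
    exact hpos t ht
  refine ⟨?_, ?_⟩
  · exact ge_of_tendsto ((continuous_re.tendsto z).comp hT) (hev.mono fun t ht => ht.1)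
  · have him : Tendsto (fun t => (∫ ω, F t ω ∂μ).im) (𝓝[≠] (0 : ℝ)) (𝓝 z.im) :=
      (continuous_im.tendsto z).comp hT
    have him0 : Tendsto (fun t => (∫ ω, F t ω ∂μ).im) (𝓝[≠] (0 : ℝ)) (𝓝 0) :=
      tendsto_const_nhds.congr' (hev.mono fun t ht => ht.2.symm)
    exact tendsto_nhds_unique him him0

/-- The same for an OS measure (`IsOSMeasure`: OS0 supplies the moments through
`HasExponentialMoments.hasAllMoments`, OS3 the positivity). [cite: GlimmJaffeQP1987, §6.1 (6.1.8) and Prop. 6.1.4] -/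
theorem IsOSMeasure.fieldPolynomial_nonneg
    (hAM : HasExponentialMoments.hasAllMoments (E := EuclideanSpace ℝ (Fin d)))
    {μ : Measure (FieldConfig (EuclideanSpace ℝ (Fin d)))} (hOS : IsOSMeasure d μ) (c : ι → ℂ)
    (f : (i : ι) → Fin (m i) → 𝓢(EuclideanSpace ℝ (Fin d), ℝ)) (hf : ∀ i j, IsPositiveTime (f i j)) :
    let z := ∫ ω, conj (fieldPolynomial c f (thetaField d ω)) * fieldPolynomial c f ω ∂μ
    0 ≤ z.re ∧ z.im = 0 := by
  haveI := hOS.isProbabilityMeasure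
  exact hOS.os3.fieldPolynomial_nonneg (hAM hOS.os0.1) c f hf

end Main

end Literature.MathematicalPhysics.QuantumLattice
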